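import Summits.AtomisticToContinuum.Crystallization.Theorems.FrustratedLawDichotomyStrainedPatchTaylorKbandKit

/-!
# SIGNED band-certificate kit for `W₄₅`: one-sided interval lemmas `−K ≤ W″`, `−K·s ≤ W′` (lens-5 g56, crux 27623 T-side, T2⁻)

Tools for the signed certificate `KbandCertSigned KbandMinus` (file `…TaylorKbandMinus`), the analytic input of the SMALL-PENALTY second-order
inequality T2⁻ = `SmoothTaylorTwo CompFamilyW tau1 delta0 G0 wMinus rho0`.  Only the ADVERSE halves of the tree kit `…TaylorKbandKit` are kept:
`BandOKMinus lo hi K := ∀ s ∈ [lo, hi] ∖ junctions, −K ≤ W″(s) ∧ −K·s ≤ W′(s)` (§2), with generic band lemmas `bump_band_minus`,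
`bump_band_minus_incr/decr`, `lj_band_minus`, `window_band_minus_lo/hi`, `far_band_minus : (closed rational hypothesis on lo, hi, K) → BandOKMinus lo hi K`
(§3) whose hypotheses are the tree's `c2`/`c4` rows only.  NEW INGREDIENT (§1): the LJ part of `−W″` is `f(s) = 7s⁻⁸ − 13s⁻¹⁴ = g(s⁻¹)`,
`g(x) = 7x⁸ − 13x¹⁴`, `g′(x) = 14x⁷(4 − 13x⁶)`; hence `f` is INCREASING on `s⁶ ≤ 13/4` and DECREASING on `s⁶ ≥ 13/4` (`negLjD2_le_of_le_peak`,
`negLjD2_le_of_peak_le`, via `antitoneOn/monotoneOn_of_deriv_…`), which replaces the decoupled envelope `7lo⁻⁸ − 13hi⁻¹⁴` (slope ≈ 10/width near the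
peak `s ≈ 1.217`, where the census constant `327/500` leaves slack `0.011`) by the exact endpoint value — 36 sub-bands instead of the census's 128.
Every hypothesis is a closed rational inequality, so each sub-band instance is ONE `norm_num` call.  0 sorry.
-/

open scoped BigOperators Classical
open Summit.AtomisticToContinuum.Crystallization.Theorems.FrustratedLawDichotomyRangeCut (Sep)
open Summit.AtomisticToContinuum.Crystallization.Theorems.FrustratedLawDichotomyMotifLemmas
open Summit.AtomisticToContinuum.Crystallization.Theorems.FrustratedLawDichotomyAveragingCut
open Summit.AtomisticToContinuum.Crystallization.Theorems.FrustratedLawDichotomyAveragingRuleCap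
open Summit.AtomisticToContinuum.Crystallization.Theorems.FrustratedLawDichotomyAveragingRuleTightFree
open Summit.AtomisticToContinuum.Crystallization.Theorems.FrustratedLawDichotomyExemptAbsorptionRecord
open Summit.AtomisticToContinuum.Crystallization.Theorems.FrustratedLawDichotomySchurCut
open Literature.MathematicalPhysics.StatisticalMechanics (lennardJones lennardJones_nonpos)
open Summit.AtomisticToContinuum.Crystallization.Theorems.FrustratedLawDichotomyRuleToolkitGood
open Summit.AtomisticToContinuum.Crystallization.Theorems.FrustratedLawDichotomyStrainedPatchHomSplit
open Summit.AtomisticToContinuum.Crystallization.Theorems.FrustratedLawDichotomyStrainedPatchHomTermCalculus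
open Summit.AtomisticToContinuum.Crystallization.Theorems.FrustratedLawDichotomyStrainedPatchChartFamilies
open Summit.AtomisticToContinuum.Crystallization.Theorems.FrustratedLawDichotomyStrainedPatchChartFamiliesBent
open Summit.AtomisticToContinuum.Crystallization.Theorems.FrustratedLawDichotomyStrainedPatchChartFamiliesPinned
open Summit.AtomisticToContinuum.Crystallization.Theorems.FrustratedLawDichotomyStrainedPatchEnvelopeLaw
open Summit.AtomisticToContinuum.Crystallization.Theorems.FrustratedLawDichotomyStrainedPatchEnvelopeTaylor

open Summit.AtomisticToContinuum.Crystallization.Theorems.FrustratedLawDichotomyStrainedPatchTaylorSplit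
open Summit.AtomisticToContinuum.Crystallization.Theorems.FrustratedLawDichotomyStrainedPatchTaylorPair
open Summit.AtomisticToContinuum.Crystallization.Theorems.FrustratedLawDichotomyStrainedPatchTaylorChord

open Summit.AtomisticToContinuum.Crystallization.Theorems.FrustratedLawDichotomyStrainedPatchTaylorLeaves
open Summit.AtomisticToContinuum.Crystallization.Theorems.FrustratedLawDichotomyStrainedPatchTaylorRegular
open Summit.AtomisticToContinuum.Crystallization.Theorems.FrustratedLawDichotomyStrainedPatchTaylorKbandKit

namespace Summit.AtomisticToContinuum.Crystallization.Theorems.FrustratedLawDichotomyStrainedPatchTaylorKbandKitSigned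

open Summit.AtomisticToContinuum.Crystallization.Theorems.FrustratedLawDichotomyFarFieldSharp (inv_pow_le_inv_pow_of_le)

/-! ## §1. Monotonicity of the LJ part of `−W″`: `f(s) = 7s⁻⁸ − 13s⁻¹⁴ = g(s⁻¹)` -/

/-- `g(x) = 7x⁸ − 13x¹⁴` has `g′(x) = 56x⁷ − 182x¹³ = 14x⁷(4 − 13x⁶)`. [formal bookkeeping] -/
theorem hasDerivAt_g (x : ℝ) : HasDerivAt (fun x : ℝ => 7 * x ^ 8 - 13 * x ^ 14) (56 * x ^ 7 - 182 * x ^ 13) x := by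
  have h := hasDerivAt_id' x
  refine (((h.pow 8).const_mul (7 : ℝ)).sub ((h.pow 14).const_mul (13 : ℝ))).congr_deriv ?_
  norm_num
  ring

/-- `g` is antitone on `[v, ∞)` once `13v⁶ ≥ 4` (`v > 0`). [folklore] -/
theorem g_anti {v u : ℝ} (hv : 0 < v) (hvu : v ≤ u) (h4 : 4 ≤ 13 * v ^ 6) :
    7 * u ^ 8 - 13 * u ^ 14 ≤ 7 * v ^ 8 - 13 * v ^ 14 := by
  have hanti : AntitoneOn (fun x : ℝ => 7 * x ^ 8 - 13 * x ^ 14) (Set.Ici v) := by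
    refine antitoneOn_of_deriv_nonpos (convex_Ici v) (by fun_prop) (by fun_prop) fun x hx => ?_
    rw [interior_Ici, Set.mem_Ioi] at hx
    have hx0 : 0 ≤ x := hv.le.trans hx.le
    have hx6 : v ^ 6 ≤ x ^ 6 := pow_le_pow_left₀ hv.le hx.le 6
    rw [(hasDerivAt_g x).deriv]
    have e : x ^ 13 = x ^ 7 * x ^ 6 := by ring
    rw [e]
    nlinarith [pow_nonneg hx0 7, mul_le_mul_of_nonneg_left (show (4:ℝ) ≤ 13 * x ^ 6 by linarith) (pow_nonneg hx0 7)]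
  exact hanti Set.self_mem_Ici (Set.mem_Ici.2 hvu) hvu

/-- `g` is monotone on `[0, y]` once `13y⁶ ≤ 4`. [folklore] -/
theorem g_mono {x y : ℝ} (hx : 0 ≤ x) (hxy : x ≤ y) (h4 : 13 * y ^ 6 ≤ 4) :
    7 * x ^ 8 - 13 * x ^ 14 ≤ 7 * y ^ 8 - 13 * y ^ 14 := by
  have hmono : MonotoneOn (fun x : ℝ => 7 * x ^ 8 - 13 * x ^ 14) (Set.Icc 0 y) := by
    refine monotoneOn_of_deriv_nonneg (convex_Icc 0 y) (by fun_prop) (by fun_prop) fun t ht => ?_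
    rw [interior_Icc, Set.mem_Ioo] at ht
    have ht0 : 0 ≤ t := ht.1.le
    have ht6 : t ^ 6 ≤ y ^ 6 := pow_le_pow_left₀ ht0 ht.2.le 6
    rw [(hasDerivAt_g t).deriv]
    have e : t ^ 13 = t ^ 7 * t ^ 6 := by ring
    rw [e]
    nlinarith [pow_nonneg ht0 7, mul_le_mul_of_nonneg_left (show 13 * t ^ 6 ≤ (4:ℝ) by linarith) (pow_nonneg ht0 7)]
  exact hmono ⟨hx, hxy⟩ ⟨hx.trans hxy, le_rfl⟩ hxy

/-- ★ `−V″` is INCREASING below the peak: `0 < s ≤ hi`, `hi⁶ ≤ 13/4` ⟹ `7s⁻⁸ − 13s⁻¹⁴ ≤ 7hi⁻⁸ − 13hi⁻¹⁴`. [folklore] -/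
theorem negLjD2_le_of_le_peak {s hi : ℝ} (hs : 0 < s) (hsh : s ≤ hi) (hpk : hi ^ 6 ≤ 13 / 4) :
    7 * s⁻¹ ^ 8 - 13 * s⁻¹ ^ 14 ≤ 7 * hi⁻¹ ^ 8 - 13 * hi⁻¹ ^ 14 := by
  have hhi : 0 < hi := hs.trans_le hsh
  have h6 : 0 < hi ^ 6 := pow_pos hhi 6
  have e : hi⁻¹ ^ 6 * hi ^ 6 = 1 := by rw [inv_pow, inv_mul_cancel₀ h6.ne']
  have h4 : 4 ≤ 13 * hi⁻¹ ^ 6 := by nlinarith [e, hpk, h6, pow_nonneg (inv_nonneg.2 hhi.le) 6]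
  exact g_anti (inv_pos.2 hhi) (inv_anti₀ hs hsh) h4

/-- ★ `−V″` is DECREASING above the peak: `0 < lo ≤ s`, `13/4 ≤ lo⁶` ⟹ `7s⁻⁸ − 13s⁻¹⁴ ≤ 7lo⁻⁸ − 13lo⁻¹⁴`. [folklore] -/
theorem negLjD2_le_of_peak_le {s lo : ℝ} (hlo : 0 < lo) (hls : lo ≤ s) (hpk : 13 / 4 ≤ lo ^ 6) :
    7 * s⁻¹ ^ 8 - 13 * s⁻¹ ^ 14 ≤ 7 * lo⁻¹ ^ 8 - 13 * lo⁻¹ ^ 14 := by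
  have hs : 0 < s := hlo.trans_le hls
  have h6 : 0 < lo ^ 6 := pow_pos hlo 6
  have e : lo⁻¹ ^ 6 * lo ^ 6 = 1 := by rw [inv_pow, inv_mul_cancel₀ h6.ne']
  have h4 : 13 * lo⁻¹ ^ 6 ≤ 4 := by nlinarith [e, hpk, h6, pow_nonneg (inv_nonneg.2 hlo.le) 6]
  exact g_mono (inv_nonneg.2 hs.le) (inv_anti₀ hlo hls) h4

/-! ## §2. The signed sub-band content -/

/-- The SIGNED certificate content on one sub-band: only the adverse (lower) curvature bounds `−K ≤ W″`, `−K·s ≤ W′`. -/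
def BandOKMinus (lo hi K : ℝ) : Prop :=
  ∀ s : ℝ, lo ≤ s → s ≤ hi → s ∉ junctions → -K ≤ deriv (deriv Wrec) s ∧ -(K * s) ≤ deriv Wrec s

/-- Adjacent sub-bands glue. [formal bookkeeping] -/
theorem BandOKMinus.union {a b c K : ℝ} (h1 : BandOKMinus a b K) (h2 : BandOKMinus b c K) : BandOKMinus a c K := by
  intro s ha hc hJ
  rcases le_or_gt s b with h | h
  · exact h1 s ha h hJ
  · exact h2 s h.le hc hJ

/-- A two-sided tree certificate is in particular a signed one. [formal bookkeeping] -/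
theorem BandOKMinus.of_bandOK {lo hi K : ℝ} (h : BandOK lo hi K) : BandOKMinus lo hi K :=
  fun s h1 h2 hJ => ⟨(abs_le.1 (h s h1 h2 hJ).1).1, (abs_le.1 (h s h1 h2 hJ).2).1⟩

/-- Raising the constant. [formal bookkeeping] -/
theorem BandOKMinus.mono {lo hi K K' : ℝ} (h : BandOKMinus lo hi K) (hK : K ≤ K') (hlo : 0 ≤ lo) : BandOKMinus lo hi K' := by
  intro s h1 h2 hJ
  obtain ⟨a, b⟩ := h s h1 h2 hJ
  have : K * s ≤ K' * s := mul_le_mul_of_nonneg_right hK (hlo.trans h1)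
  exact ⟨by linarith, by linarith⟩

/-! ## §3. Generic SIGNED band lemmas (tree `bump_band` … `far_band` with only the `c2`/`c4` rows) -/

/-- ★ BUMP-regime signed band lemma, decoupled envelope (`0 < lo ≤ s ≤ hi ≤ 8/5`). -/
theorem bump_band_minus {lo hi K : ℝ}
    (h : 0 < lo ∧ lo ≤ hi ∧ hi ≤ 8 / 5 ∧ 0 ≤ K ∧
      7 * lo⁻¹ ^ 8 - 13 * hi⁻¹ ^ 14 + 3 / 128 * ((2 - 5 * lo / 4) ^ 4 * S2 (5 * hi / 4)) ≤ K ∧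
      lo⁻¹ ^ 13 - hi⁻¹ ^ 7 + 3 / 160 * ((2 - 5 * lo / 4) ^ 5 * S1 (5 * hi / 4)) ≤ K * lo) : BandOKMinus lo hi K := by
  obtain ⟨hlo, _, hhi, hK, c2, c4⟩ := h
  intro s hls hsh hJ
  have hs0 : 0 < s := hlo.trans_le hls
  have hs85 : s < 8 / 5 := lt_of_le_of_ne (hsh.trans hhi) (fun e => hJ (mem_junctions.2 (Or.inl e)))
  have j14 := inv_pow_le_inv_pow_of_le hs0 hsh 14
  have i8 := inv_pow_le_inv_pow_of_le hlo hls 8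
  have j7 := inv_pow_le_inv_pow_of_le hs0 hsh 7
  have i13 := inv_pow_le_inv_pow_of_le hlo hls 13
  have b2 := abs_ddOmega_le (u := 5 * s / 4) (l := 5 * lo / 4) (U := 5 * hi / 4) (by linarith) (by linarith) (by linarith) (by linarith)
  have b1 := abs_dOmega_le (u := 5 * s / 4) (l := 5 * lo / 4) (U := 5 * hi / 4) (by linarith) (by linarith) (by linarith) (by linarith)
  obtain ⟨b2l, b2u⟩ := abs_le.1 b2
  obtain ⟨b1l, b1u⟩ := abs_le.1 b1
  have hKs : K * lo ≤ K * s := mul_le_mul_of_nonneg_left hls hK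
  rw [deriv2_Wrec_bump hs0 hs85, deriv_Wrec_bump hs0 hs85.le, ljD2, ljD1]
  constructor <;> linarith

/-- ★ BUMP-regime signed band lemma below the peak of `−V″` (`hi⁶ ≤ 13/4`: the LJ part is evaluated at `hi`). -/
theorem bump_band_minus_incr {lo hi K : ℝ}
    (h : 0 < lo ∧ lo ≤ hi ∧ hi ≤ 8 / 5 ∧ 0 ≤ K ∧ hi ^ 6 ≤ 13 / 4 ∧
      7 * hi⁻¹ ^ 8 - 13 * hi⁻¹ ^ 14 + 3 / 128 * ((2 - 5 * lo / 4) ^ 4 * S2 (5 * hi / 4)) ≤ K ∧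
      lo⁻¹ ^ 13 - hi⁻¹ ^ 7 + 3 / 160 * ((2 - 5 * lo / 4) ^ 5 * S1 (5 * hi / 4)) ≤ K * lo) : BandOKMinus lo hi K := by
  obtain ⟨hlo, _, hhi, hK, hpk, c2, c4⟩ := h
  intro s hls hsh hJ
  have hs0 : 0 < s := hlo.trans_le hls
  have hs85 : s < 8 / 5 := lt_of_le_of_ne (hsh.trans hhi) (fun e => hJ (mem_junctions.2 (Or.inl e)))
  have m := negLjD2_le_of_le_peak hs0 hsh hpk
  have j7 := inv_pow_le_inv_pow_of_le hs0 hsh 7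
  have i13 := inv_pow_le_inv_pow_of_le hlo hls 13
  have b2 := abs_ddOmega_le (u := 5 * s / 4) (l := 5 * lo / 4) (U := 5 * hi / 4) (by linarith) (by linarith) (by linarith) (by linarith)
  have b1 := abs_dOmega_le (u := 5 * s / 4) (l := 5 * lo / 4) (U := 5 * hi / 4) (by linarith) (by linarith) (by linarith) (by linarith)
  obtain ⟨b2l, b2u⟩ := abs_le.1 b2
  obtain ⟨b1l, b1u⟩ := abs_le.1 b1
  have hKs : K * lo ≤ K * s := mul_le_mul_of_nonneg_left hls hK
  rw [deriv2_Wrec_bump hs0 hs85, deriv_Wrec_bump hs0 hs85.le, ljD2, ljD1]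
  constructor <;> linarith

/-- ★ BUMP-regime signed band lemma above the peak of `−V″` (`13/4 ≤ lo⁶`: the LJ part is evaluated at `lo`). -/
theorem bump_band_minus_decr {lo hi K : ℝ}
    (h : 0 < lo ∧ lo ≤ hi ∧ hi ≤ 8 / 5 ∧ 0 ≤ K ∧ 13 / 4 ≤ lo ^ 6 ∧
      7 * lo⁻¹ ^ 8 - 13 * lo⁻¹ ^ 14 + 3 / 128 * ((2 - 5 * lo / 4) ^ 4 * S2 (5 * hi / 4)) ≤ K ∧
      lo⁻¹ ^ 13 - hi⁻¹ ^ 7 + 3 / 160 * ((2 - 5 * lo / 4) ^ 5 * S1 (5 * hi / 4)) ≤ K * lo) : BandOKMinus lo hi K := by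
  obtain ⟨hlo, _, hhi, hK, hpk, c2, c4⟩ := h
  intro s hls hsh hJ
  have hs0 : 0 < s := hlo.trans_le hls
  have hs85 : s < 8 / 5 := lt_of_le_of_ne (hsh.trans hhi) (fun e => hJ (mem_junctions.2 (Or.inl e)))
  have m := negLjD2_le_of_peak_le hlo hls hpk
  have j7 := inv_pow_le_inv_pow_of_le hs0 hsh 7
  have i13 := inv_pow_le_inv_pow_of_le hlo hls 13
  have b2 := abs_ddOmega_le (u := 5 * s / 4) (l := 5 * lo / 4) (U := 5 * hi / 4) (by linarith) (by linarith) (by linarith) (by linarith)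
  have b1 := abs_dOmega_le (u := 5 * s / 4) (l := 5 * lo / 4) (U := 5 * hi / 4) (by linarith) (by linarith) (by linarith) (by linarith)
  obtain ⟨b2l, b2u⟩ := abs_le.1 b2
  obtain ⟨b1l, b1u⟩ := abs_le.1 b1
  have hKs : K * lo ≤ K * s := mul_le_mul_of_nonneg_left hls hK
  rw [deriv2_Wrec_bump hs0 hs85, deriv_Wrec_bump hs0 hs85.le, ljD2, ljD1]
  constructor <;> linarith

/-- ★ PURE-LJ-regime signed band lemma (`8/5 ≤ lo ≤ s ≤ hi ≤ 3`; here `lo⁶ ≥ (8/5)⁶ > 13/4`, so `−V″ ≤ (−V″)(lo)`). -/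
theorem lj_band_minus {lo hi K : ℝ}
    (h : 8 / 5 ≤ lo ∧ lo ≤ hi ∧ hi ≤ 3 ∧ 0 ≤ K ∧
      7 * lo⁻¹ ^ 8 - 13 * lo⁻¹ ^ 14 ≤ K ∧ lo⁻¹ ^ 13 - hi⁻¹ ^ 7 ≤ K * lo) : BandOKMinus lo hi K := by
  obtain ⟨hlo, _, hhi, hK, c2, c4⟩ := h
  intro s hls hsh hJ
  have hl0 : 0 < lo := by linarith
  have hs0 : 0 < s := hl0.trans_le hls
  have hs1 : 8 / 5 < s := lt_of_le_of_ne (hlo.trans hls) (fun e => hJ (mem_junctions.2 (Or.inl e.symm)))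
  have hs2 : s < 3 := lt_of_le_of_ne (hsh.trans hhi) (fun e => hJ (mem_junctions.2 (Or.inr (Or.inl e))))
  have hpk : 13 / 4 ≤ lo ^ 6 := le_trans (by norm_num) (pow_le_pow_left₀ (by norm_num) hlo 6)
  have m := negLjD2_le_of_peak_le hl0 hls hpk
  have j7 := inv_pow_le_inv_pow_of_le hs0 hsh 7
  have i13 := inv_pow_le_inv_pow_of_le hl0 hls 13
  have hKs : K * lo ≤ K * s := mul_le_mul_of_nonneg_left hls hK
  rw [deriv2_Wrec_lj hs1 hs2, deriv_Wrec_lj hs1.le hs2.le, ljD2, ljD1]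
  constructor <;> linarith

/-- ★ WINDOW-regime signed band lemma, lower half (`3 ≤ lo ≤ s ≤ hi ≤ 15/4`): `W″ ≥ V″p + 2V′p′` (the third term `Vp″ ≥ 0`), `W′ ≥ 0`. -/
theorem window_band_minus_lo {lo hi K : ℝ}
    (h : 3 ≤ lo ∧ lo ≤ hi ∧ hi ≤ 15 / 4 ∧ 0 ≤ K ∧
      13 * hi⁻¹ ^ 14 - 7 * lo⁻¹ ^ 8 ≤ 0 ∧
      -((13 * hi⁻¹ ^ 14 - 7 * lo⁻¹ ^ 8) * (16 / 27 * (9 / 2 - lo) ^ 2 * (hi - 9 / 4)) +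
        2 * ((lo⁻¹ ^ 7 - hi⁻¹ ^ 13) * -(16 / 9 * (9 / 2 - lo) * (hi - 3)))) ≤ K) : BandOKMinus lo hi K := by
  obtain ⟨hlo, _, hhi, hK, n2, c2⟩ := h
  intro s hls hsh hJ
  have hs1 : 3 < s := lt_of_le_of_ne (hlo.trans hls) (fun e => hJ (mem_junctions.2 (Or.inr (Or.inl e.symm))))
  have hs2 : s < 9 / 2 := by linarith
  obtain ⟨⟨L0, U0⟩, ⟨L1, U1⟩, ⟨L2, U2⟩, ⟨P0, Q0⟩, ⟨P1, Q1⟩, ⟨P2, Q2⟩⟩ := window_facts hlo hls hsh (by linarith)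
  have hp2 : pW2 s ≤ 0 := by rw [pW2]; linarith
  have t1l := prod_lower_np L2 n2 P0 Q0
  have t2l := prod_lower_pn L1 U1 P1 Q1
  have t3l : 0 ≤ lennardJones s * pW2 s := mul_nonneg_of_nonpos_of_nonpos U0 hp2
  have w1l : 0 ≤ ljD1 s * pW s := mul_nonneg L1 P0
  have w2l : 0 ≤ lennardJones s * pW1 s := mul_nonneg_of_nonpos_of_nonpos U0 Q1
  have hKs : 0 ≤ K * s := mul_nonneg hK (by linarith)
  rw [deriv2_Wrec_window hs1 hs2, deriv_Wrec_window hs1.le hs2.le]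
  constructor <;> linarith

/-- ★ WINDOW-regime signed band lemma, upper half (`15/4 ≤ lo ≤ s ≤ hi ≤ 9/2`): `W″ ≥ V″p + 2V′p′ + Vp″` termwise, `W′ ≥ 0`. -/
theorem window_band_minus_hi {lo hi K : ℝ}
    (h : 15 / 4 ≤ lo ∧ lo ≤ hi ∧ hi ≤ 9 / 2 ∧ 0 ≤ K ∧
      13 * hi⁻¹ ^ 14 - 7 * lo⁻¹ ^ 8 ≤ 0 ∧ 1 / 12 * hi⁻¹ ^ 12 - 1 / 6 * lo⁻¹ ^ 6 ≤ 0 ∧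
      -((13 * hi⁻¹ ^ 14 - 7 * lo⁻¹ ^ 8) * (16 / 27 * (9 / 2 - lo) ^ 2 * (hi - 9 / 4)) +
        2 * ((lo⁻¹ ^ 7 - hi⁻¹ ^ 13) * -(16 / 9 * (9 / 2 - lo) * (hi - 3))) +
        (1 / 12 * hi⁻¹ ^ 12 - 1 / 6 * lo⁻¹ ^ 6) * ((32 * hi - 120) / 9)) ≤ K) : BandOKMinus lo hi K := by
  obtain ⟨hlo, _, hhi, hK, n2, n0, c2⟩ := h
  intro s hls hsh hJ
  have hs1 : 3 < s := by linarith
  have hs2 : s < 9 / 2 := lt_of_le_of_ne (hsh.trans hhi) (fun e => hJ (mem_junctions.2 (Or.inr (Or.inr e))))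
  obtain ⟨⟨L0, U0⟩, ⟨L1, U1⟩, ⟨L2, U2⟩, ⟨P0, Q0⟩, ⟨P1, Q1⟩, ⟨P2, Q2⟩⟩ := window_facts (by linarith) hls hsh hhi
  have hp2 : 0 ≤ pW2 s := by rw [pW2]; linarith
  have t1l := prod_lower_np L2 n2 P0 Q0
  have t2l := prod_lower_pn L1 U1 P1 Q1
  have t3l := prod_lower_np L0 n0 hp2 Q2
  have w1l : 0 ≤ ljD1 s * pW s := mul_nonneg L1 P0
  have w2l : 0 ≤ lennardJones s * pW1 s := mul_nonneg_of_nonpos_of_nonpos U0 Q1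
  have hKs : 0 ≤ K * s := mul_nonneg hK (by linarith)
  rw [deriv2_Wrec_window hs1 hs2, deriv_Wrec_window hs1.le hs2.le]
  constructor <;> linarith

/-- FAR signed band lemma (`9/2 ≤ lo`): `W₄₅ ≡ 0` beyond the range. [formal bookkeeping] -/
theorem far_band_minus {lo hi K : ℝ} (h : 9 / 2 ≤ lo ∧ 0 ≤ K) : BandOKMinus lo hi K := by
  intro s hls _ hJ
  have hs : 9 / 2 < s := lt_of_le_of_ne (h.1.trans hls) (fun e => hJ (mem_junctions.2 (Or.inr (Or.inr e.symm))))
  rw [deriv2_Wrec_far hs, deriv_Wrec_far hs.le]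
  exact ⟨neg_nonpos.2 h.2, neg_nonpos.2 (mul_nonneg h.2 (by linarith))⟩

end Summit.AtomisticToContinuum.Crystallization.Theorems.FrustratedLawDichotomyStrainedPatchTaylorKbandKitSigned
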